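import Literature.Topology.FourManifolds.SurfaceGroupCayleyCircuit
import HarnessLib

/-!
# The Cayley complex of the surface group: the winding count (pillar (B) of Nielsen's theorem)

Topic `Literature/Topology/FourManifolds`.  Last file of pillar **(B)** (planar counting,
Zieschang–Vogt–Coldewey Thm. 5.4.2 / Cor. 5.4.3) of the algebraic proof of Nielsen's theorem:
`simpleCircuitRotation_holds : SimpleCircuitRotation g` (`SurfaceGroupNielsenSetup.lean`) — a
simple circuit `w` in the Cayley graph of `S_g` which spells a signed product of conjugates of
the relator with signed count `±1` is a rotation of the relator word `r_g` or of its formal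
inverse.

**The count** (`IsSimpleCircuit.exists_sface_eq`, replacing the Jordan curve theorem of ZVC by a
winding `2`-chain).  Let `mk w = conjProd L` with `signSum L = 1`, `T = trav 1 w` and
`n = chainOf L`, so that `T` is the boundary of `n` (`SurfaceGroupCayleyFaces.lean`).  By the fan
lemma `n` takes one value `p` on all same-direction faces `S_k` of `w` and `p - 1` on all opposite
faces; by dual connectivity every face has multiplicity `p` or `p - 1`; as `S_g` is infinite and
`n` is finitely supported, `p ∈ {0, 1}`; the total mass `signSum L = 1` rules out `p = 0` and
forces the support of `n` to be a single face `F₀`, which is then every `S_k`; reading off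
(`SurfaceGroupCayleyCircuit.lean`) gives `w = r_g.rotate k₀`.  The case `signSum L = -1` is
reduced to this one by reversing the circuit (`IsSimpleCircuit.invRev`, `conjProd_flipRev`).

## References

* H. Zieschang, E. Vogt, H.-D. Coldewey, *Surfaces and Planar Discontinuous Groups*, LNM 835,
  Springer (1980), §5.4 (Thm. 5.4.2, Cor. 5.4.3). [ZieschangVogtColdewey1980]
-/

noncomputable section

namespace Literature.Topology.FourManifolds

open Literature.GroupTheory.CombinatorialGroupTheory List

namespace SurfaceGroup

variable {g : ℕ} {w : List (surfaceGen g × Bool)}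

/-! ## The count -/

/-- **The winding count** (ZVC Thm. 5.4.2 via `2`-chains): for a simple circuit spelling a signed
product of conjugates of the relator with signed count `1`, all traversals have the same
same-direction face. [cite: ZieschangVogtColdewey1980, Thm. 5.4.2] -/
theorem IsSimpleCircuit.exists_sface_eq (hg : 1 ≤ g) (hw : IsSimpleCircuit w)
    {L : List (FreeGroup (surfaceGen g) × Bool)} (hL : FreeGroup.mk w = conjProd L) (hs : signSum L = 1) :
    ∃ F₀, ∀ k (hk : k < w.length), sface (vtx 1 w k) w[k] = F₀ := by
  set n := chainOf L with hn
  have hT : ∀ e, trav 1 w e = n (Fplus e) - n (Fminus e) := trav_apply_eq_chainOf_sub hL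
  have hm := hw.length_pos
  -- the multiplicity is one value `p` on all same-direction faces …
  have hS : ∀ k (hk : k < w.length), n (sface (vtx 1 w k) w[k]) = n (sface (vtx 1 w 0) w[0]) := by
    intro k hk
    induction k with
    | zero => rfl
    | succ k ih => rw [← ih (by omega)]; exact (apply_eq_of_faceConn hT (hw.faceConn_sface_succ hk)).symm
  set p := n (sface (vtx 1 w 0) w[0]) with hp
  -- … and `p - 1` on all opposite faces
  have hO : ∀ k (hk : k < w.length), n (oface (vtx 1 w k) w[k]) = p - 1 := by
    intro k hk
    have := hw.apply_sface_sub_apply_oface hT hk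
    rw [hS k hk] at this
    linarith
  -- every face has multiplicity `p` or `p - 1`
  have hall : ∀ F, n F = p ∨ n F = p - 1 := by
    intro F
    obtain ⟨k, hk, h | h⟩ := hw.exists_faceConn F
    · exact Or.inl ((apply_eq_of_faceConn hT h).trans (hS k hk))
    · exact Or.inr ((apply_eq_of_faceConn hT h).trans (hO k hk))
  -- a face off the (finite) support has multiplicity `0`
  haveI := infinite_surfaceGroup hg
  obtain ⟨F₁, hF₁⟩ := Infinite.exists_notMem_finset n.support
  rw [Finsupp.notMem_support_iff] at hF₁
  -- the total mass is `signSum L = 1`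
  have hsum : ∑ F ∈ n.support, n F = 1 := by
    rw [← hs, ← sum_chainOf L]
    rfl
  rcases hall F₁ with h0 | h0
  · -- `p = 0`: all multiplicities are `0` or `-1`, the total mass is `≤ 0`
    exfalso
    have hp0 : p = 0 := h0.symm.trans hF₁
    have hval : ∀ F ∈ n.support, n F = -1 := fun F hF => by
      rcases hall F with h | h
      · exact absurd (h.trans hp0) (Finsupp.mem_support_iff.1 hF)
      · rw [h, hp0]; norm_num
    rw [Finset.sum_congr rfl hval, Finset.sum_const, nsmul_eq_mul, mul_neg, mul_one] at hsum
    omega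
  · -- `p = 1`: the support is a single face `F₀`, which is every same-direction face
    have hp1 : p = 1 := by have := h0.symm.trans hF₁; linarith
    have hval : ∀ F ∈ n.support, n F = 1 := fun F hF => by
      rcases hall F with h | h
      · rw [h, hp1]
      · exact absurd (by rw [h, hp1]; norm_num) (Finsupp.mem_support_iff.1 hF)
    rw [Finset.sum_congr rfl hval, Finset.sum_const, nsmul_eq_mul, mul_one] at hsum
    obtain ⟨F₀, hF₀⟩ := Finset.card_eq_one.1 (by exact_mod_cast hsum)
    refine ⟨F₀, fun k hk => ?_⟩
    have : sface (vtx 1 w k) w[k] ∈ n.support := by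
      rw [Finsupp.mem_support_iff, hS k hk, hp1]; exact one_ne_zero
    rw [hF₀, Finset.mem_singleton] at this
    exact this

/-- **Zieschang's rotation theorem, positive case**: a simple circuit spelling a signed product of
conjugates of the relator with signed count `1` is a rotation of the relator word.
[cite: ZieschangVogtColdewey1980, Thm. 5.4.2 and Cor. 5.4.3] -/
theorem IsSimpleCircuit.eq_rotate (hg : 1 ≤ g) (hw : IsSimpleCircuit w)
    {L : List (FreeGroup (surfaceGen g) × Bool)} (hL : FreeGroup.mk w = conjProd L) (hs : signSum L = 1) :
    ∃ k₀, w = (surfaceWordStd g).rotate k₀ := by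
  obtain ⟨F₀, hF⟩ := hw.exists_sface_eq hg hL hs
  exact hw.eq_rotate_of_sface_eq hF

/-! ## Reversal -/

/-- Prefixes of the formal inverse are formal inverses of suffixes. [folklore] -/
theorem take_invRev {α : Type*} (l : List (α × Bool)) (k : ℕ) :
    (FreeGroup.invRev l).take k = FreeGroup.invRev (l.drop (l.length - k)) := by
  simp only [FreeGroup.invRev, take_reverse, length_map, map_drop]

/-- Rotating and formally inverting. [folklore] -/
theorem invRev_rotate {α : Type*} (l : List (α × Bool)) (k : ℕ) :
    FreeGroup.invRev (l.rotate k) = (FreeGroup.invRev l).rotate (l.length - k % l.length) := by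
  simp only [FreeGroup.invRev, map_rotate, reverse_rotate, length_map]

/-- **The reverse of a simple circuit is a simple circuit.** [folklore] -/
theorem IsSimpleCircuit.invRev (hw : IsSimpleCircuit w) : IsSimpleCircuit (FreeGroup.invRev w) := by
  classical
  have hm := hw.length_pos
  refine ⟨fun h => ?_, ?_, ?_, fun k l hkl hl => ?_⟩
  · have := congrArg List.length h
    rw [FreeGroup.invRev_length, length_nil] at this
    omega
  · rw [FreeGroup.isReduced_iff_reduce_eq, FreeGroup.reduce_invRev, hw.2.1.reduce_eq]
  · rw [← FreeGroup.inv_mk, map_inv, hw.2.2.1, inv_one]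
  · rw [FreeGroup.invRev_length] at hl
    have key : ∀ j, proj g (FreeGroup.mk ((FreeGroup.invRev w).take j)) =
        proj g (FreeGroup.mk (w.take (w.length - j))) := by
      intro j
      rw [take_invRev, ← FreeGroup.inv_mk, map_inv]
      have := proj_mk_append (w.take (w.length - j)) (w.drop (w.length - j))
      rw [take_append_drop, hw.2.2.1] at this
      exact (eq_inv_of_mul_eq_one_left this.symm).symm
    rw [key k, key l]
    rcases Nat.eq_zero_or_pos k with rfl | hk
    · rw [Nat.sub_zero, take_of_length_le le_rfl, hw.2.2.1]
      have := hw.2.2.2 0 (w.length - l) (by omega) (by omega)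
      rwa [take_zero, ← FreeGroup.one_eq_mk, map_one] at this
    · exact (hw.2.2.2 (w.length - l) (w.length - k) (by omega) (by omega)).symm

/-- Flipping the signs and reversing the order of an expression as a signed product of
conjugates. [folklore] -/
def flipRev (L : List (FreeGroup (surfaceGen g) × Bool)) : List (FreeGroup (surfaceGen g) × Bool) :=
  (L.map fun p => (p.1, !p.2)).reverse

/-- `conjProd` of a concatenation. [folklore] -/
theorem conjProd_append (L M : List (FreeGroup (surfaceGen g) × Bool)) :
    conjProd (L ++ M) = conjProd L * conjProd M := by
  rw [conjProd, conjProd, conjProd, map_append, prod_append]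

/-- **The inverse of a signed product of conjugates** is the flipped reversed product. [folklore] -/
theorem conjProd_flipRev (L : List (FreeGroup (surfaceGen g) × Bool)) : conjProd (flipRev L) = (conjProd L)⁻¹ := by
  induction L with
  | nil => simp [flipRev, conjProd]
  | cons p L ih =>
    have hb : bsign (!p.2) = -bsign p.2 := eq_neg_of_add_eq_zero_left (bsign_bnot_add_bsign p.2)
    rw [flipRev, map_cons, reverse_cons, ← flipRev, conjProd_append, ih, conjProd_cons (p.1, !p.2) [],
      conjProd_cons p L, mul_inv_rev, conj_inv,
      show conjProd ([] : List (FreeGroup (surfaceGen g) × Bool)) = 1 from rfl, mul_one, hb, zpow_neg]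

/-- The signed count of the flipped reversed product. [folklore] -/
theorem signSum_flipRev (L : List (FreeGroup (surfaceGen g) × Bool)) : signSum (flipRev L) = -signSum L := by
  unfold signSum flipRev
  rw [map_reverse, sum_reverse, map_map]
  induction L with
  | nil => simp
  | cons p L ih =>
    rw [map_cons, sum_cons, map_cons, sum_cons, ih, Function.comp_apply, neg_add]
    have := bsign_bnot_add_bsign p.2
    linarith

/-! ## Pillar (B) -/

/-- **Pillar (B) of Nielsen's theorem: planar counting** (ZVC Thm. 5.4.2, Cor. 5.4.3, `g ≥ 1`).  A
simple circuit in the Cayley graph of `S_g` which is a signed product of conjugates of the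
relator with signed count `±1` is a rotation of the relator word `r_g = ∏ [aᵢ, bᵢ]` or of its
formal inverse — proved by the winding `2`-chain count in the Cayley complex instead of the
Jordan curve theorem. [cite: ZieschangVogtColdewey1980, Thm. 5.4.2 and Cor. 5.4.3] -/
theorem simpleCircuitRotation_holds {g : ℕ} (hg : 1 ≤ g) : SimpleCircuitRotation g := by
  intro w L hw hL hs
  rcases hs with hs | hs
  · obtain ⟨k, hk⟩ := hw.eq_rotate hg hL hs
    exact ⟨k, Or.inl hk⟩
  · have hL' : FreeGroup.mk (FreeGroup.invRev w) = conjProd (flipRev L) := by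
      rw [← FreeGroup.inv_mk, hL, conjProd_flipRev]
    have hs' : signSum (flipRev L) = 1 := by rw [signSum_flipRev, hs]; norm_num
    obtain ⟨k, hk⟩ := hw.invRev.eq_rotate hg hL' hs'
    refine ⟨(surfaceWordStd g).length - k % (surfaceWordStd g).length, Or.inr ?_⟩
    rw [← invRev_rotate, ← hk, FreeGroup.invRev_invRev]

end SurfaceGroup

end Literature.Topology.FourManifolds
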